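import Mathlib.Analysis.SpecialFunctions.SmoothTransition
import Mathlib.MeasureTheory.Integral.IntervalIntegral.FundThmCalculus
import Mathlib.Analysis.Calculus.ContDiff.Deriv
import Mathlib.Analysis.Calculus.Deriv.Slope
import Mathlib.Analysis.Calculus.Deriv.MeanValue
import HarnessLib

/-!
# A smooth concave nondecreasing splice between the identity and a constant

The elementary cut-off behind "smoothly truncated" barrier functions: a `C^∞` function
`ζ : ℝ → ℝ` with `ζ(t) = t` for `t ≤ 1/2`, `ζ` constant for `t ≥ 3/2`, `0 ≤ ζ' ≤ 1` and
`ζ'' ≤ 0` (so `ζ` is nondecreasing and concave). For a positive (super)harmonic `u` the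
composite `ζ ∘ u` is superharmonic (`Δ(ζ ∘ u) = ζ'(u) Δu + ζ''(u) |∇u|² ≤ 0`), equal to `u`
where `u ≤ 1/2` and constant where `u ≥ 3/2` — the device of Schoen–Yau, Comm. Math. Phys. 65
(1979), §2 Step 1, (2.2)–(2.3) (*"`φ = 1 + ζ(−M/4r)` … where `ζ` is a smooth concave
nondecreasing function with `ζ(t) = t` for small `t` and `ζ` constant for large `t`"*), used in
this tree to splice the conformal factor `C/(r𝒰)` of a harmonically flat end to a constant. The
construction: `ζ' = 1 − S(t − 1/2)` with Mathlib's `Real.smoothTransition` `S`, and `ζ = ∫₀ᵗ ζ'`.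

* `exists_smooth_concave_splice` — existence of such a `ζ`, with the list of its properties.

Everything is proved; nothing is defined and no named fact is introduced.

## References

* R. Schoen, S.-T. Yau, *On the proof of the positive mass conjecture in general relativity*,
  Comm. Math. Phys. 65 (1979) 45–76, §2 Step 1, (2.2)–(2.3). [SchoenYauPMT1979]
-/

noncomputable section

open Set Filter Topology MeasureTheory intervalIntegral
open scoped ContDiff

namespace Literature.Analysis.Calculus

/-- **A smooth concave nondecreasing splice.** There is `ζ ∈ C^∞(ℝ)` with `ζ(t) = t` for
`t ≤ 1/2`, `ζ(t) = ζ(2)` for `t ≥ 3/2`, `0 ≤ ζ' ≤ 1`, `ζ'' ≤ 0`; consequently `ζ` is monotone,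
`ζ(t) > 0` for `t > 0` and `ζ(2) ≥ 1/2`. (`ζ = ∫₀ᵗ (1 − S(s − 1/2)) ds` with the smooth
transition `S`.) Schoen–Yau 1979, §2 Step 1 ("a smooth concave nondecreasing function with
`ζ(t) = t` for small `t` and `ζ` constant for large `t`"). [cite: SchoenYauPMT1979, §2 Step 1 (2.2)–(2.3)] -/
theorem exists_smooth_concave_splice :
    ∃ ζ : ℝ → ℝ, ContDiff ℝ ∞ ζ ∧ (∀ t, t ≤ 1 / 2 → ζ t = t) ∧ (∀ t, 3 / 2 ≤ t → ζ t = ζ 2) ∧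
      (∀ t, 0 ≤ deriv ζ t) ∧ (∀ t, deriv ζ t ≤ 1) ∧ (∀ t, deriv (deriv ζ) t ≤ 0) ∧
      Monotone ζ ∧ (∀ t, 0 < t → 0 < ζ t) ∧ 1 / 2 ≤ ζ 2 := by
  -- the derivative
  set g : ℝ → ℝ := fun s ↦ 1 - Real.smoothTransition (s - 1 / 2) with hg_def
  have hgs : ContDiff ℝ ∞ g :=
    contDiff_const.sub (Real.smoothTransition.contDiff.comp (contDiff_id.sub contDiff_const))
  have hgc : Continuous g := hgs.continuous
  have hg0 : ∀ s, 0 ≤ g s := fun s ↦ by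
    have := Real.smoothTransition.le_one (s - 1 / 2)
    show 0 ≤ 1 - Real.smoothTransition (s - 1 / 2)
    linarith
  have hg1 : ∀ s, g s ≤ 1 := fun s ↦ by
    have := Real.smoothTransition.nonneg (s - 1 / 2)
    show 1 - Real.smoothTransition (s - 1 / 2) ≤ 1
    linarith
  have hg_small : ∀ s, s ≤ 1 / 2 → g s = 1 := fun s hs ↦ by
    show 1 - Real.smoothTransition (s - 1 / 2) = 1
    rw [Real.smoothTransition.zero_of_nonpos (by linarith), sub_zero]
  have hg_large : ∀ s, 3 / 2 ≤ s → g s = 0 := fun s hs ↦ by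
    show 1 - Real.smoothTransition (s - 1 / 2) = 0
    rw [Real.smoothTransition.one_of_one_le (by linarith), sub_self]
  have hg_anti : Antitone g := fun s t hst ↦ by
    show 1 - Real.smoothTransition (t - 1 / 2) ≤ 1 - Real.smoothTransition (s - 1 / 2)
    have := Real.smoothTransition.monotone (show s - 1 / 2 ≤ t - 1 / 2 by linarith)
    linarith
  -- the function
  set ζ : ℝ → ℝ := fun t ↦ ∫ s in (0 : ℝ)..t, g s with hζ_def
  have hderivAt : ∀ t, HasDerivAt ζ (g t) t := fun t ↦
    (hgc.integral_hasStrictDerivAt 0 t).hasDerivAt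
  have hderiv : deriv ζ = g := funext fun t ↦ (hderivAt t).deriv
  have hdiff : Differentiable ℝ ζ := fun t ↦ (hderivAt t).differentiableAt
  have hζs : ContDiff ℝ ∞ ζ := contDiff_infty_iff_deriv.2 ⟨hdiff, by rw [hderiv]; exact hgs⟩
  have hmono : Monotone ζ := monotone_of_deriv_nonneg hdiff fun t ↦ by rw [hderiv]; exact hg0 t
  -- `ζ t = t` for `t ≤ 1/2`
  have hsmall : ∀ t, t ≤ 1 / 2 → ζ t = t := by
    intro t ht
    show ∫ s in (0 : ℝ)..t, g s = t
    have heq : EqOn g (fun _ ↦ (1 : ℝ)) (uIcc 0 t) := fun s hs ↦ by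
      refine hg_small s ?_
      rcases le_total 0 t with h0t | ht0
      · rw [uIcc_of_le h0t] at hs
        exact hs.2.trans ht
      · rw [uIcc_of_ge ht0] at hs
        exact hs.2.trans (by norm_num)
    rw [integral_congr heq, intervalIntegral.integral_const, smul_eq_mul, mul_one, sub_zero]
  -- `ζ` is constant beyond `3/2`
  have hlarge' : ∀ t, 3 / 2 ≤ t → ζ t = ζ (3 / 2) := by
    intro t ht
    show ∫ s in (0 : ℝ)..t, g s = ∫ s in (0 : ℝ)..(3 / 2), g s
    have hadd := integral_add_adjacent_intervals
      (hgc.intervalIntegrable (μ := volume) 0 (3 / 2)) (hgc.intervalIntegrable (μ := volume) (3 / 2) t)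
    have hzero : ∫ s in (3 / 2 : ℝ)..t, g s = 0 := by
      have heq : EqOn g (fun _ ↦ (0 : ℝ)) (uIcc (3 / 2) t) := fun s hs ↦ by
        rw [uIcc_of_le ht] at hs
        exact hg_large s hs.1
      rw [integral_congr heq, intervalIntegral.integral_zero]
    rw [← hadd, hzero, add_zero]
  have hlarge : ∀ t, 3 / 2 ≤ t → ζ t = ζ 2 := fun t ht ↦ by
    rw [hlarge' t ht, hlarge' 2 (by norm_num)]
  -- second derivative
  have hdd : ∀ t, deriv (deriv ζ) t ≤ 0 := fun t ↦ by
    rw [hderiv]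
    exact hg_anti.deriv_nonpos
  -- positivity
  have hhalf : ζ (1 / 2) = 1 / 2 := hsmall _ le_rfl
  have hpos : ∀ t, 0 < t → 0 < ζ t := fun t ht ↦ by
    rcases le_or_gt t (1 / 2) with h | h
    · rw [hsmall t h]; exact ht
    · have := hmono h.le
      rw [hhalf] at this
      linarith
  have h2 : 1 / 2 ≤ ζ 2 := by
    have := hmono (show (1 : ℝ) / 2 ≤ 2 by norm_num)
    rwa [hhalf] at this
  exact ⟨ζ, hζs, hsmall, hlarge, fun t ↦ by rw [hderiv]; exact hg0 t,
    fun t ↦ by rw [hderiv]; exact hg1 t, hdd, hmono, hpos, h2⟩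

end Literature.Analysis.Calculus

end
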